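import Literature.AlgebraicGeometry.HodgeTheory.AnalyticModelRealizePullback
import Literature.AlgebraicGeometry.Motives.ComplexPointsEhresmann
import HarnessLib

/-!
# The analytic model of an open subscheme: `(Y|_O)^an = ψ⁻¹(O(ℂ)) ⊆ Y^an`

[topic AlgebraicGeometry/HodgeTheory]

Let `Y` be a smooth `ℂ`-scheme with an analytic model `A : AnalyticModel E m Y`
(`AbsoluteHodgeClasses`: a complex manifold `A.carrier = Y^an` charted on `E` with the comparison
homeomorphism `ψ = A.toComplexPoints : Y^an → Y(ℂ)`, an `IsAnalytification`), and let `O ⊆ Y` be a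
Zariski open subset, `Y|_O = Motives.openSubschemeOver Y O` the open subscheme as a `ℂ`-scheme
with its open immersion `ι : Y|_O ⟶ Y` (`Motives.openSubschemeOverι`). Serre [SerreGAGA1956, §2
n°5, Prop. 2 and the construction of `X^h` by recollement]: *the analytic space of a Zariski open
subset `U ⊆ X` is the open subset `U^h ⊆ X^h` with the induced structure*, and `X ↦ X^h` is
compatible with open immersions [SGA1, Exp. XII §1, Prop. 3.1 (xi)]. This file constructs that
model on the tree's carriers:

* `AnalyticModel.openSet A O` — the open subset `ψ⁻¹(O(ℂ)) ⊆ Y^an` (`Opens A.carrier`), with its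
  open-submanifold structure (Mathlib's `TopologicalSpace.Opens` instances);
* `AnalyticModel.homeomorphOpen A O : ψ⁻¹(O(ℂ)) ≃ₜ (Y|_O)(ℂ)` — the comparison homeomorphism of
  the open piece (`ψ` restricted, followed by the inverse of the open embedding
  `ι(ℂ) : (Y|_O)(ℂ) ↪ Y(ℂ)`, `AlgPoints.isOpenEmbedding_map_holds`), characterised by
  `ι(ℂ) ∘ homeomorphOpen = ψ ∘ Subtype.val` (`map_ι_homeomorphOpen`);
* `AlgPoints.evalOrZero_image_appIso_inv_map` — regular functions on `Y|_O` are regular functions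
  on opens of `Y` read through `ι(ℂ)` (`f(P) = f'(ι P)` for `f' ↔ f` under `Scheme.Hom.appIso`);
* **`AnalyticModel.restrictOpen A O : AnalyticModel E m (openSubschemeOver Y O)`** — the open
  subset `ψ⁻¹(O(ℂ))` IS the analytification of `Y|_O`: a homeomorphism onto `(Y|_O)(ℂ)`, same
  model space, and regular functions on affine opens `V ⊆ Y|_O` pull back to holomorphic
  functions because `ι(V)` is an affine open of `Y` on which they are regular
  (`IsAffineOpen.image_of_isOpenImmersion`) and `A` is an analytification; σ-compactness of the
  open piece from second countability of the σ-compact manifold `Y^an`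
  (`ChartedSpace.secondCountable_of_sigmaCompact`);
* `AnalyticModel.anMap_restrictOpen_ι : ι^an = Subtype.val` — the analytified open immersion is
  THE INCLUSION `ψ⁻¹(O(ℂ)) ↪ Y^an`; `anMap_restrictOpen_homOfLE` — for `O₁ ≤ O₂` the analytified
  inclusion `Y|_{O₁} ⟶ Y|_{O₂}` is `Set.inclusion`; hence regular functions and realisations of
  algebraic form expressions on `Y|_O` are the RESTRICTIONS of those on `Y`
  (`regularFun_restrictOpen_appTop`, `AlgFormExpr.realize_pullback_openSubschemeOverι`);
* the instances `SmoothOfRelativeDimension m (openSubschemeOver Y O).hom` (open immersion ≫ smooth)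
  and `isAffine_openSubschemeOver_left` (for `O` affine), so that the comparison files
  (`RegularFormRealization*`: `polyFormRealize`, `deRhamComparison`, P2-nat naturality) apply to the
  affine opens `U_I` of a projective `X` with the models `A.restrictOpen U_I` — the analytic side of
  the Čech–de Rham programme (Route P, nodes P1/P2 of the `lit-hodgefound` lane) [Grothendieck1966,
  p. 96 (6): the spectral sequence of an affine open cover].

Everything is proved; definitions with bodies (`openSet`, `homeomorphOpen`, `restrictOpen`,
`Motives.openSubschemeOverHomOfLE`); no named facts (net debt 0).

## References

* [SerreGAGA1956] J.-P. Serre, *Géométrie algébrique et géométrie analytique*, Ann. Inst. Fourier 6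
  (1956), §2 n°5 (définition de `X^h` par recollement; Prop. 2; fonctorialité).
* [SGA1] A. Grothendieck, M. Raynaud, *Revêtements étales et groupe fondamental*, Exp. XII §1,
  Prop. 3.1 (xi) (open immersions analytify to open immersions).
* [Grothendieck1966] A. Grothendieck, *On the de Rham cohomology of algebraic varieties*, Publ.
  Math. IHÉS 29 (1966), p. 96 (6) (Čech spectral sequence of an affine open cover).
-/

noncomputable section

universe u

open scoped Manifold ContDiff Topology
open CategoryTheory AlgebraicGeometry Set TopologicalSpace
open Literature.NumberTheory.Transcendental Literature.Geometry.Kaehler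
open Literature.AlgebraicGeometry.Motives

/-! ### §0 Regular functions on an open subscheme, read through the open immersion -/

namespace Literature.AlgebraicGeometry.Motives.AlgPoints

variable {k : Type u} [Field k] {X Y : SchemeOver k} {L : Type u} [Field L] [Algebra k L]

/-- For an open immersion `φ : X ⟶ Y`, a point `p ∈ X` lies in `U` iff `φ p` lies in `φ(U)`
(`φ` is injective on points). [cite: SGA1, Exp. XII Thm. 1.1, proof a)] -/
theorem mem_iff_base_mem_image (φ : X ⟶ Y) [IsOpenImmersion φ.left] (U : X.left.Opens)
    (p : X.left) : p ∈ U ↔ φ.left.base p ∈ φ.left ''ᵁ U := by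
  constructor
  · exact fun h ↦ ⟨p, h, rfl⟩
  · rintro ⟨q, hq, e⟩
    rwa [← φ.left.isOpenEmbedding.injective e]

/-- **Regular functions on an open subscheme are read through the open immersion**: for an open
immersion `φ : X ⟶ Y`, an open `U ⊆ X`, `f ∈ Γ(X, U)` and the corresponding section
`f' = (φ.appIso U)⁻¹ f ∈ Γ(Y, φ(U))`, the total evaluations agree: `f'(φ(P)) = f(P)` for every
`L`-point `P` of `X` (both are the junk value `0` off `U(L)`). [cite: SGA1, Exp. XII Thm. 1.1, proof a)] -/
theorem evalOrZero_image_appIso_inv_map (φ : X ⟶ Y) [IsOpenImmersion φ.left] (U : X.left.Opens)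
    (f : Γ(X.left, U)) (P : AlgPoints X L) :
    evalOrZero (φ.left ''ᵁ U) ((φ.left.appIso U).inv f) (map φ P) = evalOrZero U f P := by
  by_cases hP : P.pt ∈ U
  · have hmem : P ∈ map φ ⁻¹' (basicSet (φ.left ''ᵁ U) ((φ.left.appIso U).inv f)
        {evalOrZero U f P} : Set (AlgPoints Y L)) := by
      rw [preimage_map_basicSet_image φ U f, basicSet_eq_setOf]
      exact ⟨hP, rfl⟩
    rw [Set.mem_preimage, basicSet_eq_setOf] at hmem
    exact hmem.2
  · have hP' : (map φ P).pt ∉ φ.left ''ᵁ U := by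
      rw [pt_map]
      exact fun h ↦ hP ((mem_iff_base_mem_image φ U P.pt).2 h)
    rw [evalOrZero_of_not_mem _ hP', evalOrZero_of_not_mem _ hP]

end Literature.AlgebraicGeometry.Motives.AlgPoints

namespace Literature.AlgebraicGeometry.Motives

/-- The structure morphism `ι : Y|_O ⟶ Y` of an open subscheme is an open immersion (it is `O.ι`;
restated as an instance because instance search does not unfold `openSubschemeOverι`).
[cite: Hartshorne1977, II §3] -/
instance isOpenImmersion_openSubschemeOverι_left (Y : SchemeOver ℂ) (O : Y.left.Opens) :
    IsOpenImmersion (openSubschemeOverι Y O).left :=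
  inferInstanceAs <| IsOpenImmersion O.ι

/-- The inclusion `Y|_{O₁} ⟶ Y|_{O₂}` of open subschemes over `ℂ` for `O₁ ≤ O₂` (Mathlib
`Scheme.homOfLE`). [cite: Hartshorne1977, II §3] -/
def openSubschemeOverHomOfLE (Y : SchemeOver ℂ) {O₁ O₂ : Y.left.Opens} (h : O₁ ≤ O₂) :
    openSubschemeOver Y O₁ ⟶ openSubschemeOver Y O₂ :=
  Over.homMk (Y.left.homOfLE h) (by
    change Y.left.homOfLE h ≫ O₂.ι ≫ Y.hom = O₁.ι ≫ Y.hom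
    rw [← Category.assoc, Scheme.homOfLE_ι])

/-- The underlying morphism of `openSubschemeOverHomOfLE` is `Scheme.homOfLE` (`rfl`). [cite: Hartshorne1977, II §3] -/
@[simp]
theorem openSubschemeOverHomOfLE_left (Y : SchemeOver ℂ) {O₁ O₂ : Y.left.Opens} (h : O₁ ≤ O₂) :
    (openSubschemeOverHomOfLE Y h).left = Y.left.homOfLE h :=
  rfl

/-- `Y|_{O₁} ⟶ Y|_{O₂} ⟶ Y` is `Y|_{O₁} ⟶ Y`. [cite: Hartshorne1977, II §3] -/
theorem openSubschemeOverHomOfLE_comp_ι (Y : SchemeOver ℂ) {O₁ O₂ : Y.left.Opens} (h : O₁ ≤ O₂) :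
    openSubschemeOverHomOfLE Y h ≫ openSubschemeOverι Y O₂ = openSubschemeOverι Y O₁ := by
  ext : 1
  rw [Over.comp_left, openSubschemeOverHomOfLE_left, openSubschemeOverι_left,
    openSubschemeOverι_left]
  exact Scheme.homOfLE_ι _ h

/-- `Y|_O → Spec ℂ` is smooth of relative dimension `m` when `Y → Spec ℂ` is (an open immersion is
smooth of relative dimension `0`, and relative dimensions add under composition, Mathlib
`smoothOfRelativeDimension_comp`). [cite: Hartshorne1977, III Prop. 10.1] -/
instance smoothOfRelativeDimension_openSubschemeOver_hom (Y : SchemeOver ℂ) (O : Y.left.Opens)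
    (m : ℕ) [SmoothOfRelativeDimension m Y.hom] :
    SmoothOfRelativeDimension m (openSubschemeOver Y O).hom := by
  have h := smoothOfRelativeDimension_comp 0 m O.ι Y.hom
  rw [Nat.zero_add] at h
  exact h

/-- For an AFFINE open `O`, the open subscheme `Y|_O` is an affine scheme (by definition of
`IsAffineOpen`). [cite: Hartshorne1977, II §3] -/
theorem isAffine_openSubschemeOver_left (Y : SchemeOver ℂ) {O : Y.left.Opens}
    (hO : IsAffineOpen O) : IsAffine (openSubschemeOver Y O).left :=
  hO

/-- A point of `Y` lies in the range of `ι : Y|_O ⟶ Y` iff it lies in `O`. [cite: Hartshorne1977, II §3] -/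
theorem mem_opensRange_openSubschemeOverι_iff (Y : SchemeOver ℂ) (O : Y.left.Opens) (y : Y.left) :
    y ∈ (openSubschemeOverι Y O).left.opensRange ↔ y ∈ O := by
  constructor
  · rintro ⟨q, hq⟩
    rw [← hq]
    show O.ι.base q ∈ O
    rw [Scheme.Opens.ι_apply]
    exact q.2
  · intro hy
    exact ⟨⟨y, hy⟩, rfl⟩

/-- The image of `ι(L) : (Y|_O)(L) → Y(L)` is `O(L) = {P | P.pt ∈ O}`
(`AlgPoints.range_map_of_isOpenImmersion`). [cite: SGA1, Exp. XII Thm. 1.1, proof a)] -/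
theorem AlgPoints.range_map_openSubschemeOverι (Y : SchemeOver ℂ) (O : Y.left.Opens) :
    Set.range (AlgPoints.map (L := ℂ) (openSubschemeOverι Y O)) =
      {P : ComplexPoints Y | P.pt ∈ O} := by
  rw [AlgPoints.range_map_of_isOpenImmersion_holds (openSubschemeOverι Y O)]
  ext P
  exact mem_opensRange_openSubschemeOverι_iff Y O P.pt

end Literature.AlgebraicGeometry.Motives

namespace Literature.AlgebraicGeometry.HodgeTheory

namespace AnalyticModel

variable {E : Type} [NormedAddCommGroup E] [NormedSpace ℂ E] [FiniteDimensional ℂ E] {m : ℕ}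
  {Y : Motives.SchemeOver ℂ} (A : AnalyticModel E m Y) (O : Y.left.Opens)

/-! ### §1 The open piece `ψ⁻¹(O(ℂ)) ⊆ Y^an` -/

/-- **The open piece of `Y^an` over a Zariski open `O ⊆ Y`**: `ψ⁻¹(O(ℂ))` as an open subset of the
carrier (open because `O(ℂ) ⊆ Y(ℂ)` is open for the strong topology and `ψ` is continuous). It
carries the open-submanifold structure of Mathlib's `TopologicalSpace.Opens` instances.
[cite: SerreGAGA1956, §2 n°5] -/
def openSet : Opens A.carrier :=
  ⟨A.toComplexPoints ⁻¹' {P | P.pt ∈ O}, A.isAnalytification.isOpen_preimage O⟩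

/-- Membership in the open piece: `z ∈ ψ⁻¹(O(ℂ)) ↔ ψ(z) ∈ O(ℂ)`. [cite: SerreGAGA1956, §2 n°5] -/
theorem mem_openSet_iff (z : A.carrier) : z ∈ A.openSet O ↔ (A.toComplexPoints z).pt ∈ O :=
  Iff.rfl

/-- A point of the open piece maps into the range `O` of the open immersion `ι : Y|_O ⟶ Y`.
[cite: SerreGAGA1956, §2 n°5] -/
theorem pt_mem_opensRange_ι (z : A.openSet O) :
    (A.toComplexPoints z).pt ∈ (Motives.openSubschemeOverι Y O).left.opensRange :=
  (Motives.mem_opensRange_openSubschemeOverι_iff Y O _).2 z.2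

/-! ### §2 The comparison homeomorphism of the open piece -/

/-- **The comparison homeomorphism `ψ⁻¹(O(ℂ)) ≃ₜ (Y|_O)(ℂ)`**: `ψ` restricted to the open piece is a
homeomorphism onto `O(ℂ) ⊆ Y(ℂ)` (`Homeomorph.subtype`), and `O(ℂ)` is the range of the open
EMBEDDING `ι(ℂ) : (Y|_O)(ℂ) ↪ Y(ℂ)` (`AlgPoints.isEmbedding_map`), homeomorphic to `(Y|_O)(ℂ)`.
[cite: SerreGAGA1956, §2 n°5] [cite: SGA1, Exp. XII Prop. 3.1 (xi)] -/
def homeomorphOpen : A.openSet O ≃ₜ Motives.ComplexPoints (Motives.openSubschemeOver Y O) :=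
  (A.isAnalytification.homeomorph.subtype (p := fun z ↦ z ∈ A.openSet O)
      (q := fun P ↦ P ∈ {P : Motives.ComplexPoints Y | P.pt ∈ O}) fun _ ↦ Iff.rfl).trans
    ((Homeomorph.setCongr (Motives.AlgPoints.range_map_openSubschemeOverι Y O).symm).trans
      (Motives.AlgPoints.isEmbedding_map (L := ℂ) (Motives.openSubschemeOverι Y O)).toHomeomorph.symm)

/-- **`ι(ℂ) ∘ (comparison of the open piece) = ψ`**: the comparison homeomorphism of the open piece
lifts `ψ` along `ι(ℂ)`. [cite: SerreGAGA1956, §2 n°5] -/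
theorem map_ι_homeomorphOpen (z : A.openSet O) :
    Motives.AlgPoints.map (Motives.openSubschemeOverι Y O) (A.homeomorphOpen O z) =
      A.toComplexPoints z := by
  set hf := Motives.AlgPoints.isEmbedding_map (L := ℂ) (Motives.openSubschemeOverι Y O) with hfdef
  -- the element of `range ι(ℂ)` the last step is applied to
  set y : Set.range (Motives.AlgPoints.map (L := ℂ) (Motives.openSubschemeOverι Y O)) :=
    (Homeomorph.setCongr (Motives.AlgPoints.range_map_openSubschemeOverι Y O).symm)
      ((A.isAnalytification.homeomorph.subtype (p := fun z ↦ z ∈ A.openSet O)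
        (q := fun P ↦ P ∈ {P : Motives.ComplexPoints Y | P.pt ∈ O}) fun _ ↦ Iff.rfl) z) with hy
  have hval : (y : Motives.ComplexPoints Y) = A.toComplexPoints z := rfl
  have key : Motives.AlgPoints.map (Motives.openSubschemeOverι Y O) (hf.toHomeomorph.symm y) =
      (y : Motives.ComplexPoints Y) := by
    have h := congrArg Subtype.val (hf.toHomeomorph.apply_symm_apply y)
    rwa [Topology.IsEmbedding.toHomeomorph_apply_coe] at h
  rw [← hval, ← key]
  rfl

/-- The underlying point of the comparison of the open piece: `ι((ψ|_O z).pt) = (ψ z).pt`.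
[cite: SerreGAGA1956, §2 n°5] -/
theorem ι_base_pt_homeomorphOpen (z : A.openSet O) :
    (Motives.openSubschemeOverι Y O).left.base (A.homeomorphOpen O z).pt = (A.toComplexPoints z).pt := by
  rw [← A.map_ι_homeomorphOpen O z]
  rfl

/-! ### §3 The open piece is the analytification of the open subscheme -/

/-- A σ-compact manifold on a finite-dimensional model is second countable, so its open subsets
are σ-compact (locally compact, Hausdorff, second countable). [cite: LeeSmoothManifolds2013, Lemma 1.10 / Prop. A.60] -/
theorem sigmaCompactSpace_openSet : SigmaCompactSpace (A.openSet O) := by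
  haveI : LocallyCompactSpace E := inferInstance
  haveI : LocallyCompactSpace A.carrier := ChartedSpace.locallyCompactSpace E A.carrier
  haveI : SecondCountableTopology A.carrier := ChartedSpace.secondCountable_of_sigmaCompact E A.carrier
  haveI : LocallyCompactSpace (A.openSet O) := (A.openSet O).2.locallyCompactSpace
  haveI : SecondCountableTopology (A.openSet O) := inferInstance
  exact sigmaCompactSpace_of_locallyCompact_secondCountable

/-- **Regular functions on affine opens of `Y|_O` are holomorphic on the open piece**: for an affine
open `V ⊆ Y|_O` and `s ∈ Γ(Y|_O, V)`, `z ↦ s((ψ|_O) z)` is `s'(ψ z)` with `s' ↔ s` the section over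
the affine open `ι(V) ⊆ Y` (`AlgPoints.evalOrZero_image_appIso_inv_map`), holomorphic on
`ψ⁻¹(ι(V)(ℂ))` because `A` is an analytification, composed with the holomorphic inclusion of the
open piece. [cite: SerreGAGA1956, §2 n°5 Prop. 2] -/
theorem mdifferentiableOn_evalOrZero_homeomorphOpen
    (V : (Motives.openSubschemeOver Y O).left.affineOpens)
    (s : Γ((Motives.openSubschemeOver Y O).left, (V : (Motives.openSubschemeOver Y O).left.Opens))) :
    MDifferentiableOn 𝓘(ℂ, E) 𝓘(ℂ, ℂ)
      (fun z : A.openSet O ↦ Motives.AlgPoints.evalOrZero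
        (V : (Motives.openSubschemeOver Y O).left.Opens) s (A.homeomorphOpen O z))
      (A.homeomorphOpen O ⁻¹' {P | P.pt ∈ (V : (Motives.openSubschemeOver Y O).left.Opens)}) := by
  -- the section on the affine open `ι(V)` of `Y` corresponding to `s`
  set V' : Y.left.Opens := (Motives.openSubschemeOverι Y O).left ''ᵁ
    (V : (Motives.openSubschemeOver Y O).left.Opens) with hV'
  have hV'aff : IsAffineOpen V' := V.2.image_of_isOpenImmersion (Motives.openSubschemeOverι Y O).left
  set s' : Γ(Y.left, V') := ((Motives.openSubschemeOverι Y O).left.appIso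
    (V : (Motives.openSubschemeOver Y O).left.Opens)).inv s with hs'
  -- rewrite the function through `ι(ℂ)`
  have hfun : (fun z : A.openSet O ↦ Motives.AlgPoints.evalOrZero
      (V : (Motives.openSubschemeOver Y O).left.Opens) s (A.homeomorphOpen O z)) =
      (fun w : A.carrier ↦ Motives.AlgPoints.evalOrZero V' s' (A.toComplexPoints w)) ∘
        (Subtype.val : A.openSet O → A.carrier) := by
    funext z
    rw [Function.comp_apply, ← A.map_ι_homeomorphOpen O z]
    exact (Motives.AlgPoints.evalOrZero_image_appIso_inv_map (Motives.openSubschemeOverι Y O)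
      (V : (Motives.openSubschemeOver Y O).left.Opens) s (A.homeomorphOpen O z)).symm
  rw [hfun]
  have hA := A.isAnalytification.mdifferentiableOn_evalOrZero ⟨V', hV'aff⟩ s'
  refine hA.comp ((contMDiff_subtype_val (I := 𝓘(ℂ, E)) (n := ω)
    (U := A.openSet O)).mdifferentiable (by simp)).mdifferentiableOn fun z hz ↦ ?_
  -- the inclusion maps `(ψ|_O)⁻¹(V(ℂ))` into `ψ⁻¹(ι(V)(ℂ))`
  change (A.toComplexPoints (z : A.carrier)).pt ∈ V'
  rw [← A.ι_base_pt_homeomorphOpen O z, hV']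
  exact ⟨_, hz, rfl⟩

/-- **The open piece `ψ⁻¹(O(ℂ)) ⊆ Y^an` is the analytification of the open subscheme `Y|_O`**
[SerreGAGA1956, §2 n°5: `(Y|_O)^h = ψ⁻¹(O) ⊂ Y^h` with the induced structure; SGA1 XII Prop. 3.1
(xi)]: the comparison of the open piece is a homeomorphism onto `(Y|_O)(ℂ)`, the model space is
that of `Y^an`, and regular functions on affine opens of `Y|_O` are holomorphic.
[cite: SerreGAGA1956, §2 n°5 Prop. 2] [cite: SGA1, Exp. XII Prop. 3.1 (xi)] -/
theorem isAnalytification_homeomorphOpen :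
    IsAnalytification E (Motives.openSubschemeOver Y O) m (A.homeomorphOpen O) :=
  ⟨(A.homeomorphOpen O).isHomeomorph, A.isAnalytification.finrank_eq,
    fun V s ↦ A.mdifferentiableOn_evalOrZero_homeomorphOpen O V s⟩

/-- **The analytic model of the open subscheme `Y|_O` cut out of a model of `Y`**: carrier the open
piece `ψ⁻¹(O(ℂ)) ⊆ Y^an` with its open-submanifold structure, comparison map `homeomorphOpen`.
[cite: SerreGAGA1956, §2 n°5 Prop. 2] -/
def restrictOpen : AnalyticModel E m (Motives.openSubschemeOver Y O) where
  carrier := A.openSet O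
  sigmaCompactSpace := A.sigmaCompactSpace_openSet O
  toComplexPoints := A.homeomorphOpen O
  isAnalytification := A.isAnalytification_homeomorphOpen O

/-- The carrier of the restricted model is the open piece (definitional). [cite: SerreGAGA1956, §2 n°5] -/
theorem restrictOpen_carrier : (A.restrictOpen O).carrier = ↥(A.openSet O) :=
  rfl

/-- The comparison map of the restricted model is `homeomorphOpen` (definitional). [cite: SerreGAGA1956, §2 n°5] -/
theorem restrictOpen_toComplexPoints (z : A.openSet O) :
    (A.restrictOpen O).toComplexPoints z = A.homeomorphOpen O z :=
  rfl

/-! ### §4 The analytified open immersion is the inclusion -/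

/-- **`ι^an = Subtype.val`**: the analytification of the open immersion `ι : Y|_O ⟶ Y`, from the
restricted model to `A`, is the inclusion of the open piece `ψ⁻¹(O(ℂ)) ↪ Y^an`.
[cite: SGA1, Exp. XII Prop. 3.1 (xi)] [cite: SerreGAGA1956, §2 n°5] -/
theorem anMap_restrictOpen_ι :
    (A.restrictOpen O).anMap A (Motives.openSubschemeOverι Y O) =
      (Subtype.val : A.openSet O → A.carrier) := by
  funext z
  change A.isAnalytification.homeomorph.symm
    (Motives.AlgPoints.map (Motives.openSubschemeOverι Y O) (A.homeomorphOpen O z)) = Subtype.val z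
  rw [A.map_ι_homeomorphOpen O z]
  exact A.isAnalytification.homeomorph.symm_apply_apply (Subtype.val z)

/-- `ι^an` applied to a point of the open piece is that point of `Y^an`. [cite: SGA1, Exp. XII Prop. 3.1 (xi)] -/
theorem anMap_restrictOpen_ι_apply (z : A.openSet O) :
    (A.restrictOpen O).anMap A (Motives.openSubschemeOverι Y O) z = (z : A.carrier) :=
  congrFun (A.anMap_restrictOpen_ι O) z

/-- **Regular functions on `Y|_O` pulled back from `Y` are read by restriction**:
`(ι^* s)^an = s^an|_{ψ⁻¹(O(ℂ))}`. [cite: SerreGAGA1956, §2 n°5] -/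
theorem regularFun_restrictOpen_appTop (s : Γ(Y.left, ⊤)) :
    (A.restrictOpen O).regularFun ((Motives.openSubschemeOverι Y O).left.appTop s) =
      A.regularFun s ∘ (Subtype.val : A.openSet O → A.carrier) := by
  rw [(A.restrictOpen O).regularFun_appTop A (Motives.openSubschemeOverι Y O) s,
    anMap_restrictOpen_ι]
  rfl

/-- **Realisations restrict**: the realisation on `(Y|_O)^an` of the pulled-back expression `ι^* ξ`
is the restriction (pull-back along the inclusion of the open piece) of the realisation of `ξ` on
`Y^an`. [cite: Grothendieck1966, p. 96 (6)] [cite: SerreGAGA1956, §2 n°5] -/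
theorem _root_.Literature.AlgebraicGeometry.HodgeTheory.AlgFormExpr.realize_pullback_openSubschemeOverι
    [IsAffine Y.left] [SmoothOfRelativeDimension m Y.hom] {k : ℕ} (ξ : AlgFormExpr Y k) :
    (ξ.pullback (Motives.openSubschemeOverι Y O)).realize (A.restrictOpen O) =
      (ξ.realize A).pullback 𝓘(ℝ, E) (Subtype.val : A.openSet O → A.carrier) := by
  rw [← anMap_restrictOpen_ι]
  exact (ξ.realize_pullback_anMap (A.restrictOpen O) A (Motives.openSubschemeOverι Y O)).symm

/-! ### §5 Inclusions of open pieces -/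

variable {O} in
/-- For `O₁ ≤ O₂` the open piece over `O₁` lies in the open piece over `O₂`. [cite: SerreGAGA1956, §2 n°5] -/
theorem openSet_mono {O₁ O₂ : Y.left.Opens} (h : O₁ ≤ O₂) : A.openSet O₁ ≤ A.openSet O₂ :=
  fun _ hz ↦ h hz

/-- **The analytified inclusion `Y|_{O₁} ⟶ Y|_{O₂}` (`O₁ ≤ O₂`) is the inclusion of open pieces**
`ψ⁻¹(O₁(ℂ)) ↪ ψ⁻¹(O₂(ℂ))`. [cite: SGA1, Exp. XII Prop. 3.1 (xi)] [cite: SerreGAGA1956, §2 n°5] -/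
theorem anMap_restrictOpen_homOfLE {O₁ O₂ : Y.left.Opens} (h : O₁ ≤ O₂) :
    (A.restrictOpen O₁).anMap (A.restrictOpen O₂) (Motives.openSubschemeOverHomOfLE Y h) =
      Set.inclusion (A.openSet_mono h) := by
  funext z
  -- both sides have the same image in `Y(ℂ)` under the injective `ψ ∘ Subtype.val`
  apply Subtype.val_injective
  apply A.isAnalytification.isHomeomorph.injective
  have h1 := (A.restrictOpen O₁).toComplexPoints_anMap (A.restrictOpen O₂)
    (Motives.openSubschemeOverHomOfLE Y h) z
  have h2 : Motives.AlgPoints.map (Motives.openSubschemeOverι Y O₂) (A.homeomorphOpen O₂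
      ((A.restrictOpen O₁).anMap (A.restrictOpen O₂) (Motives.openSubschemeOverHomOfLE Y h) z)) =
      Motives.AlgPoints.map (Motives.openSubschemeOverι Y O₂)
        (Motives.AlgPoints.map (Motives.openSubschemeOverHomOfLE Y h) (A.homeomorphOpen O₁ z)) :=
    congrArg _ h1
  rw [A.map_ι_homeomorphOpen O₂, ← Motives.AlgPoints.map_comp_apply,
    Motives.openSubschemeOverHomOfLE_comp_ι, A.map_ι_homeomorphOpen O₁] at h2
  exact h2

end AnalyticModel

end Literature.AlgebraicGeometry.HodgeTheory

end
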